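import Summits.CriticalPhenomena.Ising3DConformalLimit.Theses.MonotoneRG
import Summits.CriticalPhenomena.Ising3DConformalLimit.Theses.HyperoctahedralRP
import Summits.CriticalPhenomena.Ising3DConformalLimit.Theses.IsingEuclidUpgrade
import Summits.CriticalPhenomena.Ising3DConformalLimit.Theorems.HyperoctahedralRPLimitRotationInvariant
import Summits.CriticalPhenomena.Ising3DConformalLimit.Theorems.HyperoctahedralRPHRP2Rigidity
import Summits.CriticalPhenomena.Ising3DConformalLimit.Theorems.MoebiusLimitExists.Negative.ScaleRedundant
import Summits.CriticalPhenomena.Ising3DConformalLimit.Theorems.MoebiusLimitExists.Negative.FreeTranslations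
import Literature.Probability.LatticeModels.CriticalScalingDimension
import HarnessLib

/-!
# Calibration of the crux `MonotoneRG.CovarianceUpgrade` (item stmt-CriticalPhenomena-5957):
# it is EXACTLY the conjunction of the shared items 1982 (inversion upgrade) and 0636 (U₄ ≢ 0)

Route `route-CriticalPhenomena-MonotoneRG`, sub-problem `Ising3DConformalLimit`; THEOREM-ONLY support
file of the crux's line lead (line `registered` = `Cruxes/CovarianceUpgrade/Lines/birth.lean`).

The crux `CovarianceUpgrade` says: every normalised (`S = 0` off `NonCoincident`), non-degenerate,
translation-invariant, scale-covariant (`Δ > 0`) pointwise scaling limit `S` of the critical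
nearest-neighbour Ising correlators `criticalCorr 3` on `ℤ³` is Möbius covariant with the same `Δ` and
has a not identically vanishing connected four-point function.  This file proves, sorry-free,

* `covarianceUpgrade_of_inversionUpgrade_of_nonGaussian` —
  `InversionUpgradeNormalised → IsingEuclidUpgradeR4NonGaussian → CovarianceUpgrade`
  (the line's composition: rotation invariance of the limit is the LANDED theorem
  `LimitRotationInvariant_of ∘ HRP2Rigidity_of`, items 1980/1979; inversion from 1982; `U₄` from 0636);
* `inversionUpgradeNormalised_of_covarianceUpgrade` — `CovarianceUpgrade → InversionUpgradeNormalised`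
  (the crux's extra hypothesis `0 < Δ` is automatic: `Δ ∈ [1/2, 1]` by `scalingDimension_mem_Icc_holds`,
  Simon–Lieb / infrared bounds);
* `nonGaussian_of_covarianceUpgrade` — `CovarianceUpgrade → IsingEuclidUpgradeR4NonGaussian`
  (the crux's extra hypotheses are free for ANY non-degenerate pointwise limit: normalise `S` to `0`
  off `NonCoincident` — same limit, same two-point function, same `U₄` on `NonCoincident`
  (`MoebiusLimitExistsNegative.normalised_hasLimit / normalised_nondeg / hasNontrivialU4_normalised_iff`);
  translation invariance is automatic (`isTranslationInvariant_normalised_of_limit`, the plus state at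
  `β_c` is translation invariant and meshes `t/(k+1)` realise lattice translations exactly); scale
  covariance with some `Δ' ∈ [1/2, 1]` is automatic (`exists_scaleCovariant_normalised`: Cauchy's
  equation for the two-point amplitude + Messager–Miracle-Solé monotonicity));
* `covarianceUpgrade_iff` — **`CovarianceUpgrade ↔ InversionUpgradeNormalised ∧ IsingEuclidUpgradeR4NonGaussian`**,
  and the same with the `IsingEuclidUpgrade`-namespace copy of item 0636 (`covarianceUpgrade_iff'`).

Consequence for planning (numbers, not adjectives): the crux carries no content beyond the two shared
open items — any proof of `CovarianceUpgrade` is simultaneously a proof of item 1982 (Polyakov's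
inversion/conformal-covariance postulate for Ising₃) and of item 0636 (non-triviality of Ising₃), and
conversely the day both land the crux closes by `covarianceUpgrade_iff.2 ⟨·, ·⟩`.

References: Poland–Rychkov–Vichi, Rev. Mod. Phys. 91 (2019) §II eq. (2) (conformal covariance
postulate); Aizenman, Comm. Math. Phys. 86 (1982) §1 and Aizenman–Duminil-Copin, Ann. Math. 194 (2021)
eq. (3.11) (U₄ and double currents); Simon, Comm. Math. Phys. 77 (1980) Thm. 5.1 and
Fröhlich–Simon–Spencer 1976 (the window `Δ ∈ [1/2,1]`); Friedli–Velenik 2017 Thm. 3.17 (translation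
invariance of the plus state).
-/

noncomputable section

namespace Summit.CriticalPhenomena.Ising3DConformalLimit.Cruxes.CovarianceUpgrade.Calibration

open Literature.Probability.LatticeModels
open Summit.CriticalPhenomena.Ising3DConformalLimit.Theses
open Summit.CriticalPhenomena.Ising3DConformalLimit.MoebiusLimitExistsNegative

/-- **Forward composition (the line's skeleton, hypotheses named)**: the inversion upgrade
(item 1982) and non-Gaussianity (item 0636) imply the crux `MonotoneRG.CovarianceUpgrade`; rotation
invariance of the limit is the landed theorem `LimitRotationInvariant_of` (item 1980) fed with the
landed `HRP2Rigidity_of` (item 1979). [folklore] -/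
theorem covarianceUpgrade_of_inversionUpgrade_of_nonGaussian
    (hI : HyperoctahedralRP.InversionUpgradeNormalised)
    (hU : HyperoctahedralRP.IsingEuclidUpgradeR4NonGaussian) :
    MonotoneRG.CovarianceUpgrade := by
  intro ρ Δ S hρ _hΔ hlim hnorm hnd htr hsc
  have hrot : IsRotationInvariant S :=
    Cruxes.LimitRotationInvariant.QuarterTurnLiouville.LimitRotationInvariant_of
      Cruxes.HRP2Rigidity.XRayMellin.HRP2Rigidity_of ρ Δ S hρ hlim hnorm hnd htr hsc
  have heuc : IsEuclideanInvariant S := ⟨htr, hrot⟩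
  exact ⟨⟨heuc, hsc, hI ρ Δ S hρ hlim hnorm hnd heuc hsc⟩, hU ρ S hρ hlim hnd⟩

/-- **Converse, inversion half**: the crux implies item 1982 `InversionUpgradeNormalised` outright —
the only hypothesis of the crux that item 1982 does not carry, `0 < Δ`, is automatic for a
scale-covariant non-degenerate pointwise limit of `criticalCorr 3` (`Δ ∈ [1/2, 1]`,
`scalingDimension_mem_Icc_holds`: Simon–Lieb lower bound and the infrared bound on `ℤ³`).
[cite: Simon1980, Thm. 5.1] -/
theorem inversionUpgradeNormalised_of_covarianceUpgrade (h : MonotoneRG.CovarianceUpgrade) :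
    HyperoctahedralRP.InversionUpgradeNormalised := by
  intro ρ Δ S hρ hlim hnorm hnd heuc hsc
  have hΔ : Δ ∈ Set.Icc (1 / 2 : ℝ) 1 := scalingDimension_mem_Icc_holds ρ Δ S hlim hsc hnd hρ
  have hpos : 0 < Δ := by linarith [hΔ.1]
  exact (h ρ Δ S hρ hpos hlim hnorm hnd heuc.1 hsc).1.2.2

open Classical in
/-- **Converse, non-Gaussian half**: the crux implies item 0636 `IsingEuclidUpgradeR4NonGaussian`
outright.  Given ANY non-degenerate pointwise limit `S` of `criticalCorr 3`, its normalisation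
`S' = S·𝟙_{NonCoincident}` has the same limit and two-point function, is translation invariant
(automatic for limits of the translation-invariant plus state) and scale covariant with some
`Δ' ∈ [1/2, 1]` (automatic: Cauchy equation + Messager–Miracle-Solé); the crux applied to
`(ρ, Δ', S')` gives `U₄(S') ≢ 0`, and `U₄(S') = U₄(S)` on `NonCoincident`.
[cite: FriedliVelenik2017, Thm. 3.17] -/
theorem nonGaussian_of_covarianceUpgrade (h : MonotoneRG.CovarianceUpgrade) :
    HyperoctahedralRP.IsingEuclidUpgradeR4NonGaussian := by
  intro ρ S hρ hlim hnd
  obtain ⟨Δ', hwin, hsc'⟩ := exists_scaleCovariant_normalised hρ hlim hnd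
  have hnorm' : ∀ (n : ℕ) (z : Fin n → EuclideanSpace ℝ (Fin 3)), z ∉ NonCoincident 3 n →
      (fun (n : ℕ) (x : Fin n → EuclideanSpace ℝ (Fin 3)) =>
        if x ∈ NonCoincident 3 n then S n x else 0) n z = 0 :=
    fun n z hz => if_neg hz
  have hpos : 0 < Δ' := by linarith [hwin.1]
  have h' := h ρ Δ' _ hρ hpos (normalised_hasLimit hlim) hnorm' (normalised_nondeg hnd)
    (isTranslationInvariant_normalised_of_limit hlim) hsc'
  exact hasNontrivialU4_normalised_iff.1 h'.2

/-- **Calibration**: the crux `MonotoneRG.CovarianceUpgrade` (item 5957) is EQUIVALENT to the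
conjunction of the shared items 1982 (`HyperoctahedralRP.InversionUpgradeNormalised`) and 0636
(`HyperoctahedralRP.IsingEuclidUpgradeR4NonGaussian`). [folklore] -/
theorem covarianceUpgrade_iff :
    MonotoneRG.CovarianceUpgrade ↔
      (HyperoctahedralRP.InversionUpgradeNormalised ∧
        HyperoctahedralRP.IsingEuclidUpgradeR4NonGaussian) :=
  ⟨fun h => ⟨inversionUpgradeNormalised_of_covarianceUpgrade h, nonGaussian_of_covarianceUpgrade h⟩,
    fun h => covarianceUpgrade_of_inversionUpgrade_of_nonGaussian h.1 h.2⟩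

/-- The same calibration with item 0636 read in its home route file
(`IsingEuclidUpgrade.IsingEuclidUpgradeR4NonGaussian`, definitionally the same statement). [folklore] -/
theorem covarianceUpgrade_iff' :
    MonotoneRG.CovarianceUpgrade ↔
      (HyperoctahedralRP.InversionUpgradeNormalised ∧
        IsingEuclidUpgrade.IsingEuclidUpgradeR4NonGaussian) :=
  covarianceUpgrade_iff

/-- **The crux proves non-triviality**: in particular `CovarianceUpgrade` cannot be easier than item
0636 — read through the summit: together with the route's Target `ExistsScaleCovariantLimit`
(item 1981) it gives the conjunct (this is the route's assembly `MonotoneRG.closes`), and WITHOUT the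
Target it still gives `U₄ ≢ 0` for every non-degenerate limit. [folklore] -/
theorem hasNontrivialU4_of_covarianceUpgrade (h : MonotoneRG.CovarianceUpgrade) {ρ : ℝ → ℝ}
    {S : CorrFamily 3} (hρ : ∀ δ ∈ Set.Ioc (0:ℝ) 1, 0 < ρ δ)
    (hlim : HasPointwiseScalingLimit (criticalCorr 3) ρ S) (hnd : IsNondegenerateTwoPoint S) :
    HasNontrivialU4 S :=
  nonGaussian_of_covarianceUpgrade h ρ S hρ hlim hnd

end Summit.CriticalPhenomena.Ising3DConformalLimit.Cruxes.CovarianceUpgrade.Calibration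

end
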